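import Summits.AtomisticToContinuum.HydrodynamicLimit.Theses.JParityClosure
import Summits.AtomisticToContinuum.HydrodynamicLimit.Theorems.JParityClosureParityBandClosureMomentumAtInstantPathwise
import Summits.AtomisticToContinuum.HydrodynamicLimit.Theorems.JParityClosureAssemblyEnergyFixedTime
import HarnessLib

/-!
# STUB `stub_momentumAtInstant` of the line `entropy-floor-fixes-energy` (crux `JParityClosure.ParityBandClosure`,
# stmt-AtomisticToContinuum-17608): THE MOMENTUM THIRD OF THE CONCLUSION AT EVERY INSTANT

WHAT. The registered stub `stub_momentumAtInstant` of the skeleton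
`Cruxes/ParityBandClosure/Lines/entropy_floor_fixes_energy.lean`:
`MollifiedCloseTimeAveraged → JParityClosure.EvenStressEnskog → JParityClosure.DensityCap → MomentumConjunct`
(the two skeleton-local waypoints expanded verbatim; the route's cruxes by name). In the guarded frame
(`η₀ := min η₀ᴹ (η₀'/2)`, `η₀' := min η₀ᴱ (η₀ᵉ/2)`, `η₀ᵉ` the analytic band of the PROVED `HsEosLowDensity`), for
every `t ∈ [0, T)`, every continuous `χ` and `δ > 0`, the local-Gibbs probability that the `χ`-tested empirical
momentum at time `t` deviates from `∫ χρ(t)u(t)` by more than `δ` tends to `0`.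

PROOF (quadratic time-regularity; no velocity moment beyond the conserved kinetic energy). Smooth tests suffice
(`tendsto_momentum_of_isSmooth`, energy tightness `energy_tight_of_tendstoHydroFieldsAt_zero`). For a smooth `b`,
a tolerance `κ` and a budget `δ'` — ORDER OF CHOICES (all tolerances `r`-independent): the constants `L` of `b`; the
energy level `K_E` (`exists_energy_tail_le`); the horizon `t' = (t + T)/2`; the windowed speed-jump bound
`hstat_of_evenStat_of_cap` (the inner statements of `EvenStressEnskog` — `evenStat` vocabulary, definitional — and of
`DensityCap` at `t'`, the bound `ρ ≤ ρ_max` and the guard `ρσ³ ≤ η₀'/2` on `[0, t'] × 𝕋³`, `|Y| ≤ C_Y` on `[0, η₀']`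
from `stub_readoutEvents`) gives a window `Δ_s` on which `(ε/(N+1))·½𝒮(t, t+Δ_s] ≤ κ/(24L)` off probability `δ'/8`;
the Euler time modulus of `ρu` (`exists_time_modulus`); THEN the window `Δ ≤ Δ_s`; the time-averaged input at
`(t, Δ, κ/(16L), δ'/8)` gives `r₀`; the cone modulus of `b`; THEN `r`; THEN `N₁`. For `N ≥ N₁` the deviation event
lies in the union of the energy event, the time-average event, the speed-jump event and the null bad set, by the
pathwise step `stub_momentumAtInstantPathwise` (helper file `…MomentumAtInstantPathwise`).

REFERENCES. H. Spohn, *Large Scale Dynamics of Interacting Particles* (1991), Part I §3.3; S. Chapman, T. G. Cowling,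
*The Mathematical Theory of Non-Uniform Gases* (1970) Ch. 16. No named fact is invoked: everything is proved from tree
lemmas and the implication's hypotheses.
-/

noncomputable section

namespace Summit.AtomisticToContinuum.HydrodynamicLimit.Theorems.ParityBandClosureMomentumAtInstant

open scoped BigOperators Topology Classical MeasureTheory ENNReal InnerProductSpace
open Filter Set MeasureTheory
open Literature.MathematicalPhysics.KineticTheory
open Literature.Analysis.FluidPDE
open Literature.Analysis.FunctionSpaces
open Summit.AtomisticToContinuum.HydrodynamicLimit.Theses
open Summit.AtomisticToContinuum.HydrodynamicLimit.Theorems.KineticClosureDensity (exists_modulus_euclidDist)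
open Summit.AtomisticToContinuum.HydrodynamicLimit.Theorems.KineticClosureBridge (exists_energy_tail_le exists_scale)
open Summit.AtomisticToContinuum.HydrodynamicLimit.Theorems.ChaosClosesEulerReadout
  (stub_readoutEvents euler_continuousOn exists_time_modulus exists_bound_of_continuousOn_uncurry
    exists_consts_of_isSmooth measure_le_of_forall_notMem)
open Summit.AtomisticToContinuum.HydrodynamicLimit.Theorems.JParityClosureSpeedJumpWindow (hstat_of_evenStat_of_cap)
open Summit.AtomisticToContinuum.HydrodynamicLimit.Theorems.JParityClosureEnergyModulus (configEnergy_tight_localGibbs)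

/-- **STUB `stub_momentumAtInstant` (line `entropy-floor-fixes-energy`, crux `ParityBandClosure`,
stmt-AtomisticToContinuum-17608): the momentum third at every instant.** Time-averaged `L¹(dx)` closeness of the
cone-mollified fields + `EvenStressEnskog` + `DensityCap` ⇒ `MomentumConjunct` (see the module docstring). [folklore] -/
theorem stub_momentumAtInstant :
    (∃ η₀ : ℝ, 0 < η₀ ∧ ∀ (a₀ θ₀ : T3 → ℝ) (u₀ : T3 → V3), Continuous a₀ → Continuous θ₀ → Continuous u₀ →
      (∀ x, 0 < a₀ x) → (∀ x, 0 < θ₀ x) → ∃ σ₀ : ℝ, 0 < σ₀ ∧ ∀ σ : ℝ, 0 < σ → σ < σ₀ →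
      ∀ (T : ℝ) (ρ θ : ℝ → T3 → ℝ) (u : ℝ → T3 → V3), IsHardSphereEulerSolution σ T ρ u θ →
      (∀ t ∈ Set.Ico 0 T, ∀ x, ρ t x * σ ^ 3 < η₀) →
      ∀ Φ : (N : ℕ) → HardSphereFlow (Torus.geometry (Fin 3)) (hsDiameter σ N) (N + 1),
      TendstoHydroFieldsAt (fun N => localGibbsLaw σ a₀ u₀ θ₀ N (Φ N)) Φ ρ u θ 0 →
      ∀ t ∈ Set.Ico 0 T, ∀ Δ : ℝ, 0 < Δ → t + Δ < T → ∀ η δ : ℝ, 0 < η → 0 < δ →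
      ∃ r₀ : ℝ, 0 < r₀ ∧ ∀ r : ℝ, 0 < r → r < r₀ → ∃ N₀ : ℕ, ∀ N : ℕ, N₀ ≤ N →
      let bx : T3 → T3 → ℝ := fun y x => 3 / (Real.pi * r ^ 3) * max (1 - Torus.euclidDist y x / r) 0
      localGibbsLaw σ a₀ u₀ θ₀ N (Φ N)
          {z | η * Δ < ∫ s in Set.Icc t (t + Δ),
            ((∫ x, |empiricalDensityField ((Φ N).flow s z) (fun y => bx y x) - ρ s x|)
            + (∫ x, ‖empiricalMomentumField ((Φ N).flow s z) (fun y => bx y x) - ρ s x • u s x‖)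
            + ∫ x, |empiricalEnergyField ((Φ N).flow s z) (fun y => bx y x) -
                totalEnergyDensity (ρ s x) (u s x) (θ s x)|)} ≤ ENNReal.ofReal δ) →
    JParityClosure.EvenStressEnskog → JParityClosure.DensityCap →
    ∃ η₀ : ℝ, 0 < η₀ ∧ ∀ (a₀ θ₀ : T3 → ℝ) (u₀ : T3 → V3), Continuous a₀ → Continuous θ₀ → Continuous u₀ →
      (∀ x, 0 < a₀ x) → (∀ x, 0 < θ₀ x) → ∃ σ₀ : ℝ, 0 < σ₀ ∧ ∀ σ : ℝ, 0 < σ → σ < σ₀ →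
      ∀ (T : ℝ) (ρ θ : ℝ → T3 → ℝ) (u : ℝ → T3 → V3), IsHardSphereEulerSolution σ T ρ u θ →
      (∀ t ∈ Set.Ico 0 T, ∀ x, ρ t x * σ ^ 3 < η₀) →
      ∀ Φ : (N : ℕ) → HardSphereFlow (Torus.geometry (Fin 3)) (hsDiameter σ N) (N + 1),
      TendstoHydroFieldsAt (fun N => localGibbsLaw σ a₀ u₀ θ₀ N (Φ N)) Φ ρ u θ 0 →
      ∀ t ∈ Set.Ico 0 T, ∀ χ : T3 → ℝ, Continuous χ → ∀ δ > (0 : ℝ),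
        Tendsto (fun N => localGibbsLaw σ a₀ u₀ θ₀ N (Φ N)
          {z | δ < ‖empiricalMomentumField ((Φ N).flow t z) χ - ∫ x, (χ x * ρ t x) • u t x‖}) atTop (𝓝 0) := by
  rintro ⟨η₀M, hη₀M, HM⟩ ⟨η₀E, hη₀E, HE⟩ hD
  obtain ⟨η₀e, hη₀e, F, hFan, hFeq, -, -, -⟩ := InformationPercolationEngine.HsEosLowDensity_holds
  obtain ⟨CY, hCY0, hCY⟩ := stub_readoutEvents hη₀e hFan hFeq
  -- the band
  set η₀' : ℝ := min η₀E (η₀e / 2) with hη₀'def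
  have hη₀' : 0 < η₀' := lt_min hη₀E (by positivity)
  have hη₀'E : η₀' ≤ η₀E := min_le_left _ _
  have hη₀'e : η₀' ≤ η₀e / 2 := min_le_right _ _
  set η₀ : ℝ := min η₀M (η₀' / 2) with hη₀def
  have hη₀ : 0 < η₀ := lt_min hη₀M (by positivity)
  have hη₀M' : η₀ ≤ η₀M := min_le_left _ _
  have hη₀h : η₀ ≤ η₀' / 2 := min_le_right _ _
  -- the contact value on the band
  have hY : ∀ a, 0 ≤ a → a ≤ η₀' → |contactValue a| ≤ 3 / (2 * Real.pi) * CY := fun a ha0 ha => by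
    rw [contactValue, abs_mul, abs_of_pos (by positivity : (0 : ℝ) < 3 / (2 * Real.pi))]
    exact mul_le_mul_of_nonneg_left (hCY a ⟨ha0, ha.trans hη₀'e⟩) (by positivity)
  refine ⟨η₀, hη₀, fun a₀ θ₀ u₀ ha hθ hu ha0 hθ0 => ?_⟩
  obtain ⟨σM, hσM, HM⟩ := HM a₀ θ₀ u₀ ha hθ hu ha0 hθ0
  obtain ⟨σE, hσE, HE⟩ := HE a₀ θ₀ u₀ ha hθ hu ha0 hθ0
  obtain ⟨σD, hσD, HD⟩ := hD a₀ θ₀ u₀ ha hθ hu ha0 hθ0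
  refine ⟨min (min σM σE) (min σD (1 / 2)), by positivity, fun σ hσ hσlt T ρ θ u hEul hguard Φ h0 t ht χ hχ δ hδ => ?_⟩
  have h1 : min (min σM σE) (min σD (1 / 2)) ≤ min σM σE := min_le_left _ _
  have h2 : min (min σM σE) (min σD (1 / 2)) ≤ min σD (1 / 2) := min_le_right _ _
  have hσM' : σ < σM := hσlt.trans_le (h1.trans (min_le_left _ _))
  have hσE' : σ < σE := hσlt.trans_le (h1.trans (min_le_right _ _))
  have hσD' : σ < σD := hσlt.trans_le (h2.trans (min_le_left _ _))
  have hσ2 : σ < 1 / 2 := hσlt.trans_le (h2.trans (min_le_right _ _))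
  have hσle : σ ≤ 1 / 2 := hσ2.le
  have hguardM : ∀ s ∈ Set.Ico 0 T, ∀ x, ρ s x * σ ^ 3 < η₀M := fun s hs x => (hguard s hs x).trans_le hη₀M'
  -- the inputs at this `σ`, solution, flow family and tie
  have HM := HM σ hσ hσM' T ρ θ u hEul hguardM Φ h0 t ht
  have HE := HE σ hσ hσE' Φ
  have HD := HD σ hσ hσD' T ρ θ u hEul Φ h0
  obtain ⟨ht0, htT⟩ := ht
  have hρt : Continuous (ρ t) := (hEul.smooth_density.isSmooth_slice ⟨ht0, htT⟩).continuous
  have hut : Continuous (u t) := (hEul.smooth_velocity.isSmooth_slice ⟨ht0, htT⟩).continuous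
  refine tendsto_momentum_of_isSmooth _ Φ ρ u t hρt hut
    (energy_tight_of_tendstoHydroFieldsAt_zero σ a₀ θ₀ u₀ Φ ρ θ u h0 t) ?_ χ hχ hδ
  intro b hb κ hκ
  -- §1 the horizon and the Euler fields on `[0, t']`
  set t' : ℝ := (t + T) / 2 with ht'def
  have htt' : t < t' := by rw [ht'def]; linarith only [htT]
  have ht'T : t' < T := by rw [ht'def]; linarith only [htT]
  have ht'm : t' ∈ Set.Ico 0 T := ⟨by linarith only [ht0, htt'], ht'T⟩
  obtain ⟨hρc, hmc, -⟩ := euler_continuousOn hEul le_rfl ht'T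
  obtain ⟨Cρ, hCρ0, hCρ⟩ := exists_bound_of_continuousOn_uncurry hρc
  have hρle : ∀ s ∈ Set.Icc 0 t', ∀ x, ρ s x ≤ Cρ := fun s hs x =>
    (le_abs_self _).trans (by simpa only [Real.norm_eq_abs] using hCρ s hs x)
  have hguard2 : ∀ s ∈ Set.Icc 0 t', ∀ x, ρ s x * σ ^ 3 ≤ η₀' / 2 := fun s hs x =>
    ((hguard s ⟨hs.1, hs.2.trans_lt ht'T⟩ x).le.trans hη₀h)
  -- §2 the crux and the cap in the named vocabulary (definitional), the windowed speed-jump bound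
  have hESE' : ∀ τ : ℝ, 0 < τ → ∀ χ' : ℝ × UnitAddTorus (Fin 3) → ℝ, Continuous χ' → ∀ g : ℝ → ℝ,
      Continuous g → (∀ a, η₀' ≤ a → g a = 0) → ∀ η δ : ℝ, 0 < η → 0 < δ → ∃ r₀ : ℝ, 0 < r₀ ∧
      ∀ r : ℝ, 0 < r → r < r₀ → ∃ N₀ : ℕ, ∀ N : ℕ, N₀ ≤ N → ∀ k l : Fin 3,
        localGibbsLaw σ a₀ u₀ θ₀ N (Φ N) {z | η < |evenStat σ N (Φ N) τ χ' g (evenMark k l) r z|} ≤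
          ENNReal.ofReal δ :=
    fun τ hτ χ' hχ' g hg hg0 => HE τ hτ χ' hχ' g hg fun a ha => hg0 a (hη₀'E.trans ha)
  have hcap' : ∀ η δ : ℝ, 0 < η → 0 < δ → ∃ r₀ : ℝ, 0 < r₀ ∧ ∀ r : ℝ, 0 < r → r < r₀ → ∃ N₀ : ℕ,
      ∀ N : ℕ, N₀ ≤ N → localGibbsLaw σ a₀ u₀ θ₀ N (Φ N)
        {z | ∃ s ∈ Set.Icc 0 t', ∃ x : T3, ρ s x + η < mollDensity r ((Φ N).flow s z) x} ≤ ENNReal.ofReal δ :=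
    HD t' ht'm
  have hstat := hstat_of_evenStat_of_cap hσ a₀ θ₀ u₀ Φ ρ ht0 htt' hη₀' hY hCρ0 hρle hguard2
    (configEnergy_tight_localGibbs σ a₀ θ₀ u₀ Φ ρ θ u h0) hESE' hcap'
  -- §3 the main estimate for one `e`
  have main : ∀ e : ENNReal, 0 < e → ∃ N₁ : ℕ, ∀ N : ℕ, N₁ ≤ N →
      localGibbsLaw σ a₀ u₀ θ₀ N (Φ N)
        {z | κ < ‖empiricalMomentumField ((Φ N).flow t z) b - ∫ x, (b x * ρ t x) • u t x‖} ≤ e := by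
    intro e he
    obtain ⟨δ', hδ', hδ'e⟩ : ∃ δ' : ℝ, 0 < δ' ∧ ENNReal.ofReal δ' ≤ e := by
      rcases eq_or_ne e ⊤ with h | h
      · exact ⟨1, one_pos, h ▸ le_top⟩
      · exact ⟨e.toReal, ENNReal.toReal_pos he.ne' h, (ENNReal.ofReal_toReal h).le⟩
    -- the constants of the test and the probability budget
    obtain ⟨L, hL1, hbC, -, -, -, hJ⟩ := exists_consts_of_isSmooth hb
    have hL0 : 0 < L := by linarith only [hL1]
    have hbc : Continuous b := hb.continuous
    have hJ' : ∀ k : Fin 3, Torus.IsContDiff 1 (fun x => b x • EuclideanSpace.single k (1 : ℝ)) ∧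
        (∀ x, ‖Torus.fderiv (fun x => b x • EuclideanSpace.single k (1 : ℝ)) x‖ ≤ L) :=
      fun k => ⟨(hJ k).1, (hJ k).2.1⟩
    set δ₈ : ℝ := δ' / 8 with hδ₈def
    have hδ₈ : 0 < δ₈ := by positivity
    -- energy tightness
    obtain ⟨KE, hKE0, HKE⟩ := exists_energy_tail_le (u₀ := u₀) ha hθ hu ha0 hθ0 hσle hδ₈
    -- the windowed speed-jump bound
    set ηs : ℝ := κ / (24 * L) with hηsdef
    have hηs : 0 < ηs := by positivity
    obtain ⟨Δs, hΔs, N₂, HS⟩ := hstat ηs hηs δ₈ hδ₈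
    -- the Euler time modulus of the momentum density on `[0, t']`
    set eU : ℝ := κ / (8 * L) with heUdef
    have heU : 0 < eU := by positivity
    obtain ⟨dm, hdm, Hdm⟩ := exists_time_modulus hmc heU
    -- the window
    set Δ₁ : ℝ := κ / (48 * L * (KE + 1)) with hΔ₁def
    have hΔ₁ : 0 < Δ₁ := by positivity
    set Δ : ℝ := min (min Δs (dm / 2)) (min ((t' - t) / 2) Δ₁) with hΔdef
    have hΔ : 0 < Δ := lt_min (lt_min hΔs (by positivity)) (lt_min (by linarith only [htt']) hΔ₁)
    have hΔa : Δ ≤ min Δs (dm / 2) := min_le_left _ _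
    have hΔb : Δ ≤ min ((t' - t) / 2) Δ₁ := min_le_right _ _
    have hΔΔs : Δ ≤ Δs := hΔa.trans (min_le_left _ _)
    have hΔdm2 : Δ ≤ dm / 2 := hΔa.trans (min_le_right _ _)
    have hΔdm : Δ < dm := by linarith only [hΔdm2, hdm]
    have hΔtt : Δ ≤ (t' - t) / 2 := hΔb.trans (min_le_left _ _)
    have hΔt' : t + Δ < t' := by linarith only [hΔtt, htt']
    have hΔΔ₁ : Δ ≤ Δ₁ := hΔb.trans (min_le_right _ _)
    have hΔT : t + Δ < T := hΔt'.trans ht'T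
    have u1 : 6 * L * (KE + 1) * Δ ≤ κ / 8 := by
      have h := (le_div_iff₀ (by positivity)).1 hΔΔ₁
      linarith only [h]
    -- the time-averaged input
    set κ₁ : ℝ := κ / (16 * L) with hκ₁def
    have hκ₁ : 0 < κ₁ := by positivity
    obtain ⟨r₀M, hr₀M, HM1⟩ := HM Δ hΔ hΔT κ₁ δ₈ hκ₁ hδ₈
    -- the cone modulus of the test and the scale
    set ωr : ℝ := κ / (8 * (KE + 1)) with hωrdef
    have hωr : 0 < ωr := by positivity
    obtain ⟨r₁, hr₁, hmod⟩ := exists_modulus_euclidDist hbc hωr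
    obtain ⟨r, hr, hrM, hrr₁, hr2⟩ := exists_scale hr₀M hr₁
    have hmod' : ∀ x y, Torus.euclidDist x y < r → |b x - b y| ≤ ωr := fun x y h => hmod x y (h.trans_le hrr₁)
    obtain ⟨N₀M, HM2⟩ := HM1 r hr hrM
    -- the small parameters against `κ`
    have v2 : L * ηs = κ / 24 := by rw [hηsdef]; field_simp
    have v3 : ωr * (KE + 1) = κ / 8 := by rw [hωrdef]; field_simp
    have v4 : L * κ₁ = κ / 16 := by rw [hκ₁def]; field_simp
    have v5 : L * eU = κ / 8 := by rw [heUdef]; field_simp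
    have u2 : 3 * L * ηs ≤ κ / 8 := by linarith only [v2]
    have u3 : ωr * (KE + 1) ≤ κ / 8 := v3.le
    have u4 : 2 * L * κ₁ ≤ κ / 8 := by linarith only [v4]
    have u5 : L * eU ≤ κ / 8 := v5.le
    refine ⟨max N₀M N₂, fun N hN => ?_⟩
    have hNM : N₀M ≤ N := (le_max_left _ _).trans hN
    have hNS : N₂ ≤ N := (le_max_right _ _).trans hN
    refine le_trans ?_ hδ'e
    -- this `N`: the null bad set, the pathwise step, the union bound
    have hgood : localGibbsLaw σ a₀ u₀ θ₀ N (Φ N) (Φ N).goodᶜ = 0 := localGibbsLaw_compl_good σ a₀ θ₀ u₀ N (Φ N)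
    have key : ∀ z ∈ (Φ N).good, ((N : ℝ) + 1)⁻¹ * configEnergy ((Φ N).flow 0 z) ≤ KE →
        (∫ s in Set.Icc t (t + Δ),
          ((∫ x, |empiricalDensityField ((Φ N).flow s z) (fun y => DensityCapNegative.cone r y x) - ρ s x|)
          + (∫ x, ‖empiricalMomentumField ((Φ N).flow s z) (fun y => DensityCapNegative.cone r y x) - ρ s x • u s x‖)
          + ∫ x, |empiricalEnergyField ((Φ N).flow s z) (fun y => DensityCapNegative.cone r y x) -
              totalEnergyDensity (ρ s x) (u s x) (θ s x)|)) ≤ κ₁ * Δ →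
        hsDiameter σ N * ((N : ℝ) + 1)⁻¹ * (2⁻¹ *
          collisionalTransferFunctional (Torus.geometry (Fin 3)) (hsDiameter σ N)
            (fun i _ pre post => ‖(post i).2 - (pre i).2‖) (fun s => (Φ N).flow s z) t (t + Δs)) ≤ ηs →
        ‖empiricalMomentumField ((Φ N).flow t z) b - ∫ x, (b x * ρ t x) • u t x‖ ≤ 5 * κ / 8 :=
      fun z hz n1 n2 n3 =>
      stub_momentumAtInstantPathwise hσ (Φ N) hz hEul ht0 hΔ hΔT hΔΔs hbc hL0 hbC hJ' n1 hr hr2 hωr hmod' hκ₁ n2 n3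
        (fun s hs x => (Hdm s ⟨ht0.trans hs.1, hs.2.trans hΔt'.le⟩ t ⟨ht0, htt'.le⟩
          (by rw [abs_of_nonneg (sub_nonneg.2 hs.1)]; linarith only [hs.2, hΔdm]) x).le)
        u1 u2 u3 u4 u5
    refine measure_le_of_forall_notMem (localGibbsLaw σ a₀ u₀ θ₀ N (Φ N)) (HKE N (Φ N) 0) (HM2 N hNM) (HS N hNS)
      (HKE N (Φ N) 0) (HKE N (Φ N) 0) (HKE N (Φ N) 0) hgood (by linarith only [hδ₈def, hδ'])
      fun z n1 n2 n3 _ _ _ n7 hzD => ?_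
    simp only [Set.mem_setOf_eq, Set.mem_compl_iff, not_not, not_lt] at n1 n2 n3 n7 hzD
    have hk := key z n7 n1 n2 n3
    linarith only [hk, hzD, hκ]
  exact ENNReal.tendsto_atTop_zero.2 fun e he => main e he

end Summit.AtomisticToContinuum.HydrodynamicLimit.Theorems.ParityBandClosureMomentumAtInstant

end
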